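import Summits.CriticalPhenomena.SAWScalingLimit.Theorems.SAWDefectDecoherenceBoundaryClosureRTransportChart
import Summits.CriticalPhenomena.SAWScalingLimit.Theorems.SAWDefectDecoherenceBoundaryClosureRTransportFrame
import Summits.CriticalPhenomena.SAWScalingLimit.Theorems.SAWDefectDecoherenceBoundaryClosureRFrameTransport
import Summits.CriticalPhenomena.SAWScalingLimit.Theorems.SAWDefectDecoherenceBoundaryClosureRInnerPolygonsHalfLattice
import HarnessLib

/-!
# `BoundaryClosureR` (stmt-CriticalPhenomena-14004), line `polygon-parity-squeeze`, stub
# `transportRigidity` (E), part F4b: the one-phase boundary pairing at a flat point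

Heart of the identification step (E).  With `K := (g · e^{-(5/8)(L - L_b)}) ∘ Φ⁻¹` on `ℍ` and
`ν := (re Φ*)_* (c₀ · wt · μ|_G)` (`wt = lim |Φ'|^{3/8}` from inside, `G` the flat part of `∂Ω`),
`flat_pairing` proves the hypothesis `hpair` of `realLine_rigidity` at `y = Φ*(z₀)` for a flat
boundary point `z₀`: `∫_{B(y,r) ∩ ℍ} K ∂̄φ = e^{iθ₀} ∫ φ dν`, `ν(y-r,y+r) < ∞`, `K ∈ L¹(B(y,r) ∩ ℍ)`,
with ONE phase (`c₀ e^{iθ₀} = -√3 i e^{i(3/8) im L_b} e^{(5/8) L_b}`).  Ingredients: the chart `(G, M)`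
at `z₀` (F4a), `frameTransport_dbar` with `Ψ = (φ ∘ G) e^{(3/8) M}`, the identity K2i for `Ψ`,
and on the side `e^{(3/8) M} = wt · e^{i(3/8)α}` with `e^{i(3/8)α}` constant (PHASE + K2c) and
`n_k κ(z₀) e^{i(3/8)α} = i e^{i(3/8) im L_b}` (PHASE).
References: H. Duminil-Copin, S. Smirnov, Ann. of Math. 175 (2012), §3; Hörmander (1973), §1.1.
-/

noncomputable section

open scoped Topology ComplexConjugate ContDiff ENNReal Classical
open Filter Set Metric Complex MeasureTheory
open UpperHalfPlane (upperHalfPlaneSet)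
open Literature.Probability.LatticeModels Literature.Probability.RandomPlanarGeometry
open Literature.Analysis.Complex (dbarAlong)

namespace Summit.CriticalPhenomena.SAWScalingLimit.Theorems.PolygonParitySqueeze

namespace Transport

/-- `exp ((3/8) m) = exp ((3/8) re m) · exp (i (3/8) im m)`. [folklore] -/
theorem exp_three_eighths_split (m : ℂ) :
    Complex.exp ((3 / 8 : ℂ) * m) =
      ((Real.exp ((3 / 8 : ℝ) * m.re) : ℝ) : ℂ) * Complex.exp ((3 / 8 : ℂ) * (m.im : ℂ) * I) := by
  rw [Complex.ofReal_exp, ← Complex.exp_add]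
  congr 1
  apply Complex.ext <;> simp

/-- Distance of real points seen in `ℂ`. [folklore] -/
theorem mem_ball_ofReal_iff {x y r : ℝ} : (x : ℂ) ∈ ball (y : ℂ) r ↔ x ∈ Ioo (y - r) (y + r) := by
  rw [mem_ball, dist_eq_norm, ← ofReal_sub, norm_real, Real.norm_eq_abs, abs_sub_lt_iff, mem_Ioo]
  constructor <;> rintro ⟨h1, h2⟩ <;> constructor <;> linarith

/-- **The one-phase boundary pairing at a flat point** (hypothesis `hpair` of `realLine_rigidity`
for the transported data; see the module docstring).
[cite: DuminilCopinSmirnov2012, §3 (boundary behaviour of the observable)] -/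
theorem flat_pairing (D : DobrushinDomain) (Λ : ℝ → Finset HexVertex)
    (Φ : ConformalEquiv D.carrier upperHalfPlaneSet)
    {Φs : ℂ → ℂ} (hΦsc : ContinuousOn Φs (closure D.carrier \ {D.pt 0}))
    (hΦse : EqOn Φs Φ D.carrier) (hΦsr : ∀ p ∈ frontier D.carrier, (Φs p).im = 0)
    (hΦsi : InjOn Φs (closure D.carrier \ {D.pt 0}))
    {L : ℂ → ℂ} {Lb : ℂ} (hL : ContinuousOn L D.carrier)
    (hexp : ∀ z ∈ D.carrier, Complex.exp (L z) = deriv Φ z)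
    {g : ℂ → ℂ} (hgi : ∀ K : Set ℂ, IsCompact K → IntegrableOn g (K ∩ D.carrier))
    {μ : Measure ℂ} (hμK : ∀ K : Set ℂ, IsCompact K → D.pt 0 ∉ K → μ K < ⊤)
    (hμs : μ (frontier D.carrier)ᶜ = 0)
    {κ : ℂ → ℂ}
    (hK2c : (∀ z ∈ frontier D.carrier, z ≠ D.pt 0 → ∀ (k : Fin 6) (s : ℝ), 0 < s → D.carrier ∩ Metric.ball z s = halfPlane k z ∩ Metric.ball z s → (∀ᶠ δ : ℝ in 𝓝[>] 0, ∃ nthr : ℤ, ∀ v : HexVertex, (δ : ℂ) * hexCenter v ∈ Metric.ball z s → (v ∈ Λ δ ↔ nthr ≤ zigzagForm k v)) → D.pt 0 ∉ Metric.closedBall z s → ∀ z' ∈ frontier D.carrier ∩ Metric.ball z s, κ z' = κ z))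
    (hK2i : (∀ z ∈ frontier D.carrier, z ≠ D.pt 0 → ∀ (k : Fin 6) (s : ℝ), 0 < s → D.carrier ∩ Metric.ball z s = halfPlane k z ∩ Metric.ball z s → (∀ᶠ δ : ℝ in 𝓝[>] 0, ∃ nthr : ℤ, ∀ v : HexVertex, (δ : ℂ) * hexCenter v ∈ Metric.ball z s → (v ∈ Λ δ ↔ nthr ≤ zigzagForm k v)) → D.pt 0 ∉ Metric.closedBall z s → ∀ φ : ℂ → ℂ, ContDiff ℝ ∞ φ → HasCompactSupport φ → tsupport φ ⊆ Metric.ball z (s / 2) → ∫ w in D.carrier, g w * Literature.Analysis.Complex.dbarAlong 1 φ w = -(Real.sqrt 3 : ℂ) * innerNormal k * κ z * ∫ w, φ w ∂μ))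
    (hPH : (∀ z ∈ frontier D.carrier, z ≠ D.pt 0 → ∀ (k : Fin 6) (s : ℝ), 0 < s → D.carrier ∩ Metric.ball z s = halfPlane k z ∩ Metric.ball z s → (∀ᶠ δ : ℝ in 𝓝[>] 0, ∃ nthr : ℤ, ∀ v : HexVertex, (δ : ℂ) * hexCenter v ∈ Metric.ball z s → (v ∈ Λ δ ↔ nthr ≤ zigzagForm k v)) → D.pt 0 ∉ Metric.closedBall z s → ∃ α : ℝ, Filter.Tendsto (fun w => (L w).im) (𝓝[D.carrier] z) (𝓝 α) ∧ κ z * innerNormal k * Complex.exp ((3 / 8 : ℂ) * (α : ℂ) * Complex.I) = Complex.I * Complex.exp ((3 / 8 : ℂ) * (Lb.im : ℂ) * Complex.I)))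
    {Gs : Set ℂ} (hGm : MeasurableSet Gs) (hGsub : Gs ⊆ frontier D.carrier \ {D.pt 0})
    {wt : ℂ → ℝ}
    (hwt : ∀ z, wt z = Real.exp ((3 / 8 : ℝ) * limUnder (𝓝[D.carrier] z) (fun w => (L w).re)))
    (hwtm : AEMeasurable wt (μ.restrict Gs))
    (hΦrm : AEMeasurable (fun z => (Φs z).re) (μ.restrict Gs))
    {c₀ θ₀ : ℝ} (hc₀ : 0 < c₀)
    (hC : (c₀ : ℂ) * Complex.exp ((θ₀ : ℂ) * I) =
      -(Real.sqrt 3 : ℂ) * I * Complex.exp ((3 / 8 : ℂ) * (Lb.im : ℂ) * I) *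
        Complex.exp ((5 / 8 : ℂ) * Lb))
    {ν : Measure ℝ}
    (hν : ν = Measure.map (fun z => (Φs z).re)
      ((μ.restrict Gs).withDensity fun z => ENNReal.ofReal (c₀ * wt z)))
    {K : ℂ → ℂ}
    (hK : ∀ w : ℂ, 0 < w.im → K w = g (Φ.symm w) * Complex.exp (-(5 / 8 : ℂ) * (L (Φ.symm w) - Lb)))
    {z₀ : ℂ} (hz₀ : z₀ ∈ frontier D.carrier) {k : Fin 6} {s : ℝ} (hs : 0 < s)
    (hflat : D.carrier ∩ ball z₀ s = halfPlane k z₀ ∩ ball z₀ s)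
    (hlat : ∀ᶠ δ : ℝ in 𝓝[>] 0, ∃ nthr : ℤ, ∀ v : HexVertex,
      (δ : ℂ) * hexCenter v ∈ ball z₀ s → (v ∈ Λ δ ↔ nthr ≤ zigzagForm k v))
    (h0 : D.pt 0 ∉ closedBall z₀ s)
    (hGball : frontier D.carrier ∩ ball z₀ s ⊆ Gs)
    {rmax : ℝ} (hrmax : 0 < rmax) :
    ∃ r : ℝ, 0 < r ∧ r ≤ rmax ∧
      ν (Ioo ((Φs z₀).re - r) ((Φs z₀).re + r)) < ⊤ ∧
      IntegrableOn K (ball (((Φs z₀).re : ℝ) : ℂ) r ∩ {w : ℂ | 0 < w.im}) ∧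
      ∀ φ : ℂ → ℂ, ContDiff ℝ ∞ φ → HasCompactSupport φ →
        tsupport φ ⊆ ball (((Φs z₀).re : ℝ) : ℂ) r →
        ∫ w in ball (((Φs z₀).re : ℝ) : ℂ) r ∩ {w : ℂ | 0 < w.im}, K w * dbarAlong 1 φ w =
          Complex.exp ((θ₀ : ℂ) * I) *
            ∫ x in Ioo ((Φs z₀).re - r) ((Φs z₀).re + r), φ x ∂ν := by
  have hU : IsOpen D.carrier := D.isOpen
  -- the direction of the side
  set n : ℂ := innerNormal k with hndef
  have hn1 : ‖n‖ = 1 := norm_innerNormal k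
  have hn0 : n ≠ 0 := fun h => by simp [h] at hn1
  have hflat' : D.carrier ∩ ball z₀ s = {w : ℂ | 0 < ((w - z₀) * conj n).re} ∩ ball z₀ s := by
    rw [hflat]; rfl
  have hz₀0 : z₀ ≠ D.pt 0 := fun h => h0 (h ▸ mem_closedBall_self hs.le)
  have hz₀cl : z₀ ∈ closure D.carrier := frontier_subset_closure hz₀
  have hne0 : ∀ w ∈ ball z₀ s, w ≠ D.pt 0 := fun w hw h => h0 (h ▸ ball_subset_closedBall hw)
  -- Step 1: the chart
  obtain ⟨s₁, G, M, hs₁, hs₁s, hGd, hGinj, hGeq, hGpos, hGzero, hGder, hMd, hMexp, hML⟩ :=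
    exists_frameChart D Φ hΦsc hΦse hΦsr hΦsi hL hexp hn1 hs hflat' h0
  have hb : ball z₀ s₁ ⊆ ball z₀ s := ball_subset_ball hs₁s
  have hb4 : ball z₀ (s₁ / 4) ⊆ ball z₀ s₁ := ball_subset_ball (by linarith)
  -- the real point `y = Φ*(z₀)`
  set y : ℝ := (Φs z₀).re with hy
  have hyc : ((y : ℝ) : ℂ) = Φs z₀ := Complex.ext (by simp [hy]) (by simp [hΦsr z₀ hz₀])
  have hGz₀ : G z₀ = y := by rw [hGeq ⟨hz₀cl, mem_ball_self hs⟩, hyc]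
  -- Step 2: a disc `B(y, r)` inside the open image `G(B(z₀, s₁/4))`
  have hU₁o : IsOpen (G '' ball z₀ (s₁ / 4)) := Literature.Analysis.Complex.SCV.isOpen_image_of_injOn
    rfl (hGd.mono (hb4.trans hb)) isOpen_ball (hGinj.mono (hb4.trans hb))
  have hyU : ((y : ℝ) : ℂ) ∈ G '' ball z₀ (s₁ / 4) := ⟨z₀, mem_ball_self (by linarith), hGz₀⟩
  obtain ⟨r₁, hr₁, hr₁U⟩ := Metric.isOpen_iff.1 hU₁o _ hyU
  set r : ℝ := min r₁ rmax with hr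
  have hr0 : 0 < r := lt_min hr₁ hrmax
  have hrU : ball ((y : ℝ) : ℂ) r ⊆ G '' ball z₀ (s₁ / 4) := (ball_subset_ball (min_le_left _ _)).trans hr₁U
  -- Step 3: frontier points with boundary value in `B(y, r)` lie in `B(z₀, s₁/4)`
  have hpre : ∀ z ∈ frontier D.carrier, z ≠ D.pt 0 →
      (((Φs z).re : ℝ) : ℂ) ∈ ball ((y : ℝ) : ℂ) r → z ∈ ball z₀ (s₁ / 4) := fun z hz hz0 hzr => by
    have hzre : (((Φs z).re : ℝ) : ℂ) = Φs z := Complex.ext (by simp) (by simp [hΦsr z hz])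
    obtain ⟨z', hz', hGz'⟩ := hrU hzr
    have hz's : z' ∈ ball z₀ s := hb (hb4 hz')
    have hfr' : z' ∈ frontier D.carrier := hGzero z' hz's (by rw [hGz', ofReal_im])
    have h1 : Φs z' = Φs z := by rw [← hGeq ⟨frontier_subset_closure hfr', hz's⟩, hGz', hzre]
    have h2 : z' = z := hΦsi ⟨frontier_subset_closure hfr', fun h => hne0 z' hz's h⟩
      ⟨frontier_subset_closure hz, fun h => hz0 h⟩ h1
    rwa [← h2]
  -- Step 4: the side points of `B(z₀, s₁)`: line equation, limits of `L`, the weight, the phase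
  have hline : ∀ z ∈ frontier D.carrier ∩ ball z₀ s, ((z - z₀) * conj n).re = 0 :=
    fun z hz => (mem_frontier_iff_of_flatDir hU hn0 hflat' hz.2).1 hz.1
  have hLt : ∀ z ∈ ball z₀ s₁, Tendsto L (𝓝[D.carrier] z) (𝓝 (M z)) :=
    fun z hz => chart_tendsto hMd.continuousOn hML hz
  have hwtz : ∀ z ∈ closure D.carrier ∩ ball z₀ s₁, wt z = Real.exp ((3 / 8 : ℝ) * (M z).re) := fun z hz => by
    haveI : NeBot (𝓝[D.carrier] z) := mem_closure_iff_nhdsWithin_neBot.1 hz.1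
    have h1 : Tendsto (fun w => (L w).re) (𝓝[D.carrier] z) (𝓝 (M z).re) :=
      (Complex.continuous_re.tendsto _).comp (hLt z hz.2)
    rw [hwt z, h1.limUnder_eq]
  -- PHASE at `z₀`
  obtain ⟨α₀, -, hα₀⟩ := hPH z₀ hz₀ hz₀0 k s hs hflat hlat h0
  set u₀ : ℂ := Complex.exp ((3 / 8 : ℂ) * (α₀ : ℂ) * I) with hu₀
  have hκn : κ z₀ * n ≠ 0 := fun h => by
    rw [hndef] at h; rw [h, zero_mul] at hα₀
    exact (mul_ne_zero I_ne_zero (Complex.exp_ne_zero _)) hα₀.symm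
  have hphase : ∀ z ∈ frontier D.carrier ∩ ball z₀ s₁,
      Complex.exp ((3 / 8 : ℂ) * ((M z).im : ℂ) * I) = u₀ := by
    rintro z ⟨hzf, hz1⟩
    have hzs : z ∈ ball z₀ s := hb hz1
    have hz0 : z ≠ D.pt 0 := hne0 z hzs
    -- the flat data at `z`
    set sz : ℝ := s - dist z z₀ with hsz
    have hsz0 : 0 < sz := by rw [hsz, sub_pos]; exact mem_ball.1 hzs
    have hsub : ball z sz ⊆ ball z₀ s := fun w hw => by rw [mem_ball] at hw ⊢; linarith [dist_triangle w z z₀]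
    have hsubc : closedBall z sz ⊆ closedBall z₀ s := fun w hw => by
      rw [mem_closedBall] at hw ⊢; linarith [dist_triangle w z z₀]
    have hflatz : D.carrier ∩ ball z sz = halfPlane k z ∩ ball z sz :=
      flatDir_subball hflat' (hline z ⟨hzf, hzs⟩) hsub
    have hlatz : ∀ᶠ δ : ℝ in 𝓝[>] 0, ∃ nthr : ℤ, ∀ v : HexVertex,
        (δ : ℂ) * hexCenter v ∈ ball z sz → (v ∈ Λ δ ↔ nthr ≤ zigzagForm k v) :=
      hlat.mono fun δ ⟨nthr, h⟩ => ⟨nthr, fun v hv => h v (hsub hv)⟩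
    have h0z : D.pt 0 ∉ closedBall z sz := fun h => h0 (hsubc h)
    obtain ⟨αz, hαzt, hαz⟩ := hPH z hzf hz0 k sz hsz0 hflatz hlatz h0z
    -- `αz = im (M z)`
    haveI : NeBot (𝓝[D.carrier] z) := mem_closure_iff_nhdsWithin_neBot.1 (frontier_subset_closure hzf)
    have h1 : Tendsto (fun w => (L w).im) (𝓝[D.carrier] z) (𝓝 (M z).im) :=
      (Complex.continuous_im.tendsto _).comp (hLt z hz1)
    rw [hK2c z₀ hz₀ hz₀0 k s hs hflat hlat h0 z ⟨hzf, hzs⟩, tendsto_nhds_unique hαzt h1, ← hα₀] at hαz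
    exact mul_left_cancel₀ hκn hαz
  have hexpM : ∀ z ∈ frontier D.carrier ∩ ball z₀ s₁,
      Complex.exp ((3 / 8 : ℂ) * M z) = ((wt z : ℝ) : ℂ) * u₀ := fun z hz => by
    rw [exp_three_eighths_split, hphase z hz, hwtz z ⟨frontier_subset_closure hz.1, hz.2⟩]
  -- Step 5: the transported region `S` and its image
  set S : Set ℂ := D.carrier ∩ (ball z₀ s₁ ∩ G ⁻¹' ball ((y : ℝ) : ℂ) r) with hS
  have hSo : IsOpen S := hU.inter (hGd.continuousOn.mono hb |>.isOpen_inter_preimage isOpen_ball isOpen_ball)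
  have hSm : MeasurableSet S := hSo.measurableSet
  have hS1 : S ⊆ ball z₀ s₁ := fun z hz => hz.2.1
  have hS4 : S ⊆ ball z₀ (s₁ / 4) := fun z hz => by
    obtain ⟨z', hz', hGz'⟩ := hrU hz.2.2
    rwa [← hGinj (hb (hb4 hz')) (hb hz.2.1) hGz']
  have hGΦ : ∀ z ∈ S, G z = Φ z := fun z hz => by rw [hGeq ⟨subset_closure hz.1, hb hz.2.1⟩, hΦse hz.1]
  have hSimg : G '' S = ball ((y : ℝ) : ℂ) r ∩ {w : ℂ | 0 < w.im} := by
    apply Subset.antisymm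
    · rintro _ ⟨z, hz, rfl⟩
      exact ⟨hz.2.2, show 0 < (G z).im by rw [hGΦ z hz]; exact Φ.mapsTo hz.1⟩
    · rintro w ⟨hw, hwim⟩
      obtain ⟨z', hz', rfl⟩ := hrU hw
      exact ⟨z', ⟨hGpos z' (hb (hb4 hz')) hwim, hb4 hz', hw⟩, rfl⟩
  have hsymm : ∀ z ∈ S, Φ.symm (G z) = z := fun z hz => by rw [hGΦ z hz]; exact Φ.symm_apply_apply hz.1
  have hinv : ∀ z ∈ S, Function.invFunOn G (ball z₀ s₁) (G z) = z := fun z hz =>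
    (hGinj.mono hb).leftInvOn_invFunOn hz.2.1
  have hMLS : ∀ z ∈ S, M z = L z := fun z hz => hML ⟨hz.1, hz.2.1⟩
  have hSsub : S ⊆ closedBall z₀ s₁ ∩ D.carrier := fun z hz => ⟨ball_subset_closedBall hz.2.1, hz.1⟩
  have hgS : IntegrableOn g S := (hgi _ (isCompact_closedBall z₀ s₁)).mono_set hSsub
  -- Step 6: `K ∈ L¹(B(y, r) ∩ ℍ)` by the change of variables `w = G z`
  have hd : ∀ z ∈ S, HasFDerivWithinAt G
      ((ContinuousLinearMap.smulRight (1 : ℂ →L[ℂ] ℂ) (deriv G z)).restrictScalars ℝ) S z :=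
    fun z hz => ((hGd.differentiableAt (isOpen_ball.mem_nhds (hb hz.2.1))).hasDerivAt.hasFDerivAt
      |>.restrictScalars ℝ).hasFDerivWithinAt
  set Fc : ℂ → ℂ := fun z => ((‖deriv G z‖ ^ 2 : ℝ) : ℂ) * Complex.exp (-(5 / 8 : ℂ) * (M z - Lb))
    with hFc
  have hG'c : ContinuousOn (deriv G) (ball z₀ s) := ((hGd.analyticOnNhd isOpen_ball).deriv).continuousOn
  have hFcc : ContinuousOn Fc (ball z₀ s₁) := by
    exact (continuous_ofReal.comp_continuousOn ((hG'c.mono hb).norm.pow 2)).mul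
      ((hMd.continuousOn.sub continuousOn_const).const_smul (-(5 / 8 : ℂ))).cexp
  have hcb4 : closedBall z₀ (s₁ / 4) ⊆ ball z₀ s₁ := closedBall_subset_ball (by linarith)
  obtain ⟨C, hCb⟩ := (isCompact_closedBall z₀ (s₁ / 4)).exists_bound_of_continuousOn (hFcc.mono hcb4)
  have hKG : ∀ z ∈ S, K (G z) = g z * Complex.exp (-(5 / 8 : ℂ) * (L z - Lb)) :=
    fun z hz => by rw [hK _ (by rw [hGΦ z hz]; exact Φ.mapsTo hz.1), hsymm z hz]
  have hKint : IntegrableOn K (ball ((y : ℝ) : ℂ) r ∩ {w : ℂ | 0 < w.im}) := by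
    rw [← hSimg]
    refine (integrableOn_image_iff_integrableOn_abs_det_fderiv_smul volume hSm hd
      (hGinj.mono (hS1.trans hb)) K).2 ?_
    have h1 : IntegrableOn (fun z => Fc z * g z) S := by
      refine Integrable.bdd_mul (c := C) hgS ((hFcc.mono hS1).aestronglyMeasurable hSm) ?_
      exact (ae_restrict_iff' hSm).2 (Eventually.of_forall fun z hz =>
        hCb z (ball_subset_closedBall (hS4 hz)))
    refine h1.congr_fun (fun z hz => ?_) hSm
    dsimp only
    rw [Literature.Analysis.Complex.LengthArea.det_restrictScalars_smulRight,
      abs_of_nonneg (by positivity), hKG z hz, Complex.real_smul]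
    simp only [hFc]
    rw [hMLS z hz]; ring
  -- Step 7: `ν(y - r, y + r) < ∞`
  set μG : Measure ℂ := μ.restrict Gs with hμG
  set dens : ℂ → ℝ≥0∞ := fun z => ENNReal.ofReal (c₀ * wt z) with hdens
  set μw : Measure ℂ := μG.withDensity dens with hμw
  have hΦr_w : AEMeasurable (fun z => (Φs z).re) μw := hΦrm.mono_ac (withDensity_absolutelyContinuous _ _)
  obtain ⟨Cw, hCw⟩ := (isCompact_closedBall z₀ (s₁ / 4)).exists_bound_of_continuousOn
    ((hMd.continuousOn.const_smul (3 / 8 : ℂ)).cexp.norm.mono hcb4)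
  have hwt_le : ∀ z ∈ closedBall z₀ (s₁ / 4) ∩ Gs, wt z ≤ Cw := by
    intro z hz
    have hz1 : z ∈ ball z₀ s₁ := hcb4 hz.1
    have h := hCw z hz.1
    rw [Real.norm_eq_abs, abs_of_nonneg (norm_nonneg _), Complex.norm_exp] at h
    rw [hwtz z ⟨(hGsub hz.2).1 |> frontier_subset_closure, hz1⟩]
    convert h using 2
    simp
  have h0B : D.pt 0 ∉ closedBall z₀ (s₁ / 4) := fun h => h0 (closedBall_subset_closedBall (by linarith) h)
  have hνfin : ν (Ioo (y - r) (y + r)) < ⊤ := by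
    rw [hν, Measure.map_apply_of_aemeasurable hΦr_w measurableSet_Ioo]
    have hsub : (fun z => (Φs z).re) ⁻¹' Ioo (y - r) (y + r) ⊆ closedBall z₀ (s₁ / 4) ∪ Gsᶜ := by
      intro z hz
      by_cases hzG : z ∈ Gs
      · left
        exact ball_subset_closedBall
          (hpre z (hGsub hzG).1 (hGsub hzG).2 (mem_ball_ofReal_iff.2 hz))
      · exact Or.inr hzG
    refine lt_of_le_of_lt (measure_mono hsub) (lt_of_le_of_lt (measure_union_le _ _) ?_)
    have h1 : μw Gsᶜ = 0 := by
      rw [hμw, withDensity_apply _ hGm.compl, hμG, Measure.restrict_restrict hGm.compl,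
        compl_inter_self, Measure.restrict_empty, lintegral_zero_measure]
    have h2 : μw (closedBall z₀ (s₁ / 4)) < ⊤ := by
      rw [hμw, withDensity_apply _ measurableSet_closedBall, hμG,
        Measure.restrict_restrict measurableSet_closedBall]
      calc ∫⁻ z in closedBall z₀ (s₁ / 4) ∩ Gs, dens z ∂μ
          ≤ ∫⁻ _ in closedBall z₀ (s₁ / 4) ∩ Gs, ENNReal.ofReal (c₀ * Cw) ∂μ :=
            setLIntegral_mono' (measurableSet_closedBall.inter hGm) fun z hz =>
              ENNReal.ofReal_le_ofReal (mul_le_mul_of_nonneg_left (hwt_le z hz) hc₀.le)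
        _ = ENNReal.ofReal (c₀ * Cw) * μ (closedBall z₀ (s₁ / 4) ∩ Gs) := setLIntegral_const _ _
        _ < ⊤ := ENNReal.mul_lt_top ENNReal.ofReal_lt_top
            (lt_of_le_of_lt (measure_mono inter_subset_left)
              (hμK _ (isCompact_closedBall _ _) h0B))
    rw [h1, add_zero]
    exact h2
  -- Step 8: the pairing identity
  refine ⟨r, hr0, min_le_right _ _, hνfin, hKint, fun φ hφ hφc hφsupp => ?_⟩
  -- the transported test function
  set Ψ : ℂ → ℂ := fun z => if z ∈ ball z₀ s₁ then φ (G z) * Complex.exp ((3 / 8 : ℂ) * M z) else 0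
    with hΨ
  have hΨin : ∀ z ∈ ball z₀ s₁, Ψ z = φ (G z) * Complex.exp ((3 / 8 : ℂ) * M z) :=
    fun z hz => by simp only [hΨ, if_pos hz]
  have hΨout : ∀ z ∉ ball z₀ s₁, Ψ z = 0 := fun z hz => by simp only [hΨ, if_neg hz]
  obtain ⟨hΨsm, hΨcpt, hΨsupp, hΨzero⟩ := testFunction_transport hs₁ (hGd.mono hb) (hGinj.mono hb) hMd
    hφ (hφsupp.trans hrU) hΨin hΨout
  -- (a) change of variables
  have hφV : tsupport φ ⊆ G '' ball z₀ s₁ := (hφsupp.trans hrU).trans (image_mono hb4)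
  have hKint' : IntegrableOn (fun w => g (Function.invFunOn G (ball z₀ s₁) w) *
      Complex.exp (-(5 / 8 : ℂ) * M (Function.invFunOn G (ball z₀ s₁) w))) (G '' S) := by
    have h1 : IntegrableOn (fun w => Complex.exp (-(5 / 8 : ℂ) * Lb) * K w) (G '' S) := by
      rw [hSimg]; exact hKint.const_mul _
    refine h1.congr_fun ?_ (by rw [hSimg]; exact measurableSet_ball.inter (isOpen_lt continuous_const continuous_im).measurableSet)
    rintro _ ⟨z, hz, rfl⟩
    dsimp only
    rw [hinv z hz, hKG z hz, hMLS z hz, mul_left_comm, ← Complex.exp_add,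
      show -(5 / 8 : ℂ) * Lb + -(5 / 8 : ℂ) * (L z - Lb) = -(5 / 8 : ℂ) * L z by ring]
  have hT := frameTransport_dbar (ball z₀ s₁) S G M g φ isOpen_ball hSm hS1 (hGd.mono hb)
    (hGinj.mono hb) hMd hMexp hφ hφc hφV hgS hKint'
  -- (b) the left-hand side is `e^{-(5/8) Lb} ∫ K ∂̄φ`
  have hLHS : ∫ w in G '' S, g (Function.invFunOn G (ball z₀ s₁) w) *
      Complex.exp (-(5 / 8 : ℂ) * M (Function.invFunOn G (ball z₀ s₁) w)) * dbarAlong 1 φ w =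
      Complex.exp (-(5 / 8 : ℂ) * Lb) *
        ∫ w in ball ((y : ℝ) : ℂ) r ∩ {w : ℂ | 0 < w.im}, K w * dbarAlong 1 φ w := by
    rw [← integral_const_mul, hSimg]
    refine setIntegral_congr_fun (measurableSet_ball.inter
      (isOpen_lt continuous_const continuous_im).measurableSet) ?_
    intro w hw
    rw [← hSimg] at hw
    obtain ⟨z, hz, rfl⟩ := hw
    dsimp only
    rw [hinv z hz, hKG z hz, hMLS z hz,
      show -(5 / 8 : ℂ) * (L z - Lb) = -(5 / 8 : ℂ) * L z - (-(5 / 8 : ℂ) * Lb) by ring, Complex.exp_sub]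
    field_simp
  -- (c) the right-hand side is `∫_Ω g ∂̄Ψ`
  have hΨ₀ : ∀ z ∈ ball z₀ s₁,
      dbarAlong 1 (fun z => φ (G z) * Complex.exp ((3 / 8 : ℂ) * M z)) z = dbarAlong 1 Ψ z := fun z hz =>
    Literature.Analysis.Complex.dbarAlong_congr_of_eventuallyEq
      (by filter_upwards [isOpen_ball.mem_nhds hz] with w hw; exact (hΨin w hw).symm) 1
  have hRHS1 : ∫ z in S, g z * dbarAlong 1 (fun z => φ (G z) * Complex.exp ((3 / 8 : ℂ) * M z)) z =
      ∫ z in S, g z * dbarAlong 1 Ψ z :=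
    setIntegral_congr_fun hSm fun z hz => by rw [hΨ₀ z (hS1 hz)]
  have hdbar0 : ∀ z ∈ D.carrier \ S, dbarAlong 1 Ψ z = 0 := by
    intro z hz
    apply Literature.Analysis.Complex.dbarAlong_eq_zero_of_eventuallyEq_zero
    by_cases hz1 : z ∈ ball z₀ s₁
    · have hGz : G z ∉ ball ((y : ℝ) : ℂ) r := fun h => hz.2 ⟨hz.1, hz1, h⟩
      have hφ0 : φ =ᶠ[𝓝 (G z)] 0 := notMem_tsupport_iff_eventuallyEq.1 fun h => hGz (hφsupp h)
      have hGc : ContinuousAt G z := (hGd.mono hb).continuousOn.continuousAt (isOpen_ball.mem_nhds hz1)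
      filter_upwards [hGc.preimage_mem_nhds hφ0, isOpen_ball.mem_nhds hz1] with w hw hw1
      rw [hΨin w hw1, show φ (G w) = 0 from hw, zero_mul, Pi.zero_apply]
    · have hz4 : z ∈ (closedBall z₀ (s₁ / 4))ᶜ := fun h => hz1 (hcb4 h)
      filter_upwards [isClosed_closedBall.isOpen_compl.mem_nhds hz4] with w hw
      rw [Pi.zero_apply]
      exact hΨzero w fun h => hw (ball_subset_closedBall h)
  have hRHS2 : ∫ z in D.carrier, g z * dbarAlong 1 Ψ z = ∫ z in S, g z * dbarAlong 1 Ψ z :=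
    setIntegral_eq_of_subset_of_forall_sdiff_eq_zero hU.measurableSet (fun z hz => hz.1)
      fun z hz => by rw [hdbar0 z hz, mul_zero]
  -- (d) the local continuum identity K2i for `Ψ`
  have hK2 := hK2i z₀ hz₀ hz₀0 k s hs hflat hlat h0 Ψ hΨsm hΨcpt
    (hΨsupp.trans (closedBall_subset_ball (by linarith)))
  -- (e) the boundary integral `∫ Ψ dμ = u₀ · J`
  have hwt_nn : ∀ z, 0 ≤ wt z := fun z => by rw [hwt z]; exact (Real.exp_pos _).le
  set J : ℂ := ∫ z in Gs, ((wt z : ℝ) : ℂ) * φ (((Φs z).re : ℝ) : ℂ) ∂μ with hJ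
  have hΨμ : ∫ w, Ψ w ∂μ = u₀ * J := by
    have h1 : ∫ w in Gs, Ψ w ∂μ = ∫ w, Ψ w ∂μ := by
      refine setIntegral_eq_integral_of_ae_compl_eq_zero ?_
      have hae : ∀ᵐ x ∂μ, x ∈ frontier D.carrier := by
        rw [ae_iff]; exact hμs
      filter_upwards [hae] with x hx hxG
      exact hΨzero x fun hx4 => hxG (hGball ⟨hx, hb (hb4 hx4)⟩)
    rw [← h1, hJ, ← integral_const_mul]
    refine setIntegral_congr_fun hGm fun z hzG => ?_
    have hzf : z ∈ frontier D.carrier := (hGsub hzG).1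
    have hzre : (((Φs z).re : ℝ) : ℂ) = Φs z := Complex.ext (by simp) (by simp [hΦsr z hzf])
    by_cases hz1 : z ∈ ball z₀ s₁
    · rw [hΨin z hz1, hexpM z ⟨hzf, hz1⟩, hGeq ⟨frontier_subset_closure hzf, hb hz1⟩, hzre]
      ring
    · rw [hΨout z hz1]
      have : φ (((Φs z).re : ℝ) : ℂ) = 0 :=
        image_eq_zero_of_notMem_tsupport fun h =>
          hz1 (hb4 (hpre z hzf (hGsub hzG).2 (hφsupp h)))
      rw [this, mul_zero, mul_zero]
  -- (f) the transported measure: `∫ φ dν = c₀ · J`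
  have hdens : AEMeasurable (fun z => ENNReal.ofReal (c₀ * wt z)) (μ.restrict Gs) :=
    ENNReal.measurable_ofReal.comp_aemeasurable (hwtm.const_mul c₀)
  have hνint : ∫ x in Ioo (y - r) (y + r), φ x ∂ν = (c₀ : ℂ) * J := by
    have h1 : ∫ x in Ioo (y - r) (y + r), φ x ∂ν = ∫ x, φ x ∂ν := by
      refine setIntegral_eq_integral_of_forall_compl_eq_zero fun x hx => ?_
      exact image_eq_zero_of_notMem_tsupport fun h => hx (mem_ball_ofReal_iff.1 (hφsupp h))
    rw [h1, hν, integral_map (f := fun x : ℝ => φ (x : ℂ)) hΦr_w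
        (by exact (hφ.continuous.comp continuous_ofReal).aestronglyMeasurable),
      integral_withDensity_eq_integral_toReal_smul₀ hdens
        (Eventually.of_forall fun z => ENNReal.ofReal_lt_top), hJ, ← integral_const_mul]
    refine integral_congr_ae (Eventually.of_forall fun z => ?_)
    dsimp only
    rw [ENNReal.toReal_ofReal (mul_nonneg hc₀.le (hwt_nn z)), Complex.real_smul]
    push_cast; ring
  -- (g) assembly
  have hmain : Complex.exp (-(5 / 8 : ℂ) * Lb) *
      (∫ w in ball ((y : ℝ) : ℂ) r ∩ {w : ℂ | 0 < w.im}, K w * dbarAlong 1 φ w) =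
      -(Real.sqrt 3 : ℂ) * innerNormal k * κ z₀ * (u₀ * J) := by
    rw [← hLHS, hT, hRHS1, ← hRHS2, hK2, hΨμ]
  rw [hνint]
  have hEE : Complex.exp (-(5 / 8 : ℂ) * Lb) * Complex.exp ((5 / 8 : ℂ) * Lb) = 1 := by
    rw [← Complex.exp_add, show -(5 / 8 : ℂ) * Lb + (5 / 8 : ℂ) * Lb = 0 by ring, Complex.exp_zero]
  have hα₀' : innerNormal k * κ z₀ * u₀ = I * Complex.exp ((3 / 8 : ℂ) * (Lb.im : ℂ) * I) := by
    rw [← hα₀]; ring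
  have key : -(Real.sqrt 3 : ℂ) * innerNormal k * κ z₀ * (u₀ * J) =
      -(Real.sqrt 3 : ℂ) * (I * Complex.exp ((3 / 8 : ℂ) * (Lb.im : ℂ) * I)) * J := by
    rw [← hα₀']; ring
  apply mul_left_cancel₀ (Complex.exp_ne_zero (-(5 / 8 : ℂ) * Lb))
  rw [hmain, key, show Complex.exp (-(5 / 8 : ℂ) * Lb) * (Complex.exp ((θ₀ : ℂ) * I) * ((c₀ : ℂ) * J)) =
    Complex.exp (-(5 / 8 : ℂ) * Lb) * ((c₀ : ℂ) * Complex.exp ((θ₀ : ℂ) * I)) * J by ring, hC]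
  linear_combination (Real.sqrt 3 : ℂ) * I * Complex.exp ((3 / 8 : ℂ) * (Lb.im : ℂ) * I) * J * hEE

/-! ### Registered form -/

/-- **Registered helper `transport_flatPairing`** (∀-closed form of `flat_pairing`; sub-goal F4b
of stub `transportRigidity` (E), crux stmt-CriticalPhenomena-14004, line `polygon-parity-squeeze`).
[cite: DuminilCopinSmirnov2012, §3 (boundary behaviour of the observable)] -/
theorem transport_flatPairing : ∀ (D : DobrushinDomain) (Λ : ℝ → Finset HexVertex) (Φ : ConformalEquiv D.carrier UpperHalfPlane.upperHalfPlaneSet) (Φs L : ℂ → ℂ) (Lb : ℂ) (g : ℂ → ℂ) (μ : MeasureTheory.Measure ℂ) (κ : ℂ → ℂ) (Gs : Set ℂ) (wt : ℂ → ℝ) (c₀ θ₀ : ℝ) (ν : MeasureTheory.Measure ℝ) (K : ℂ → ℂ) (z₀ : ℂ) (k : Fin 6) (s rmax : ℝ), ContinuousOn Φs (closure D.carrier \ {D.pt 0}) → Set.EqOn Φs Φ D.carrier → (∀ p ∈ frontier D.carrier, (Φs p).im = 0) → Set.InjOn Φs (closure D.carrier \ {D.pt 0}) → ContinuousOn L D.carrier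 → (∀ z ∈ D.carrier, Complex.exp (L z) = deriv Φ z) → (∀ K' : Set ℂ, IsCompact K' → MeasureTheory.IntegrableOn g (K' ∩ D.carrier)) → (∀ K' : Set ℂ, IsCompact K' → D.pt 0 ∉ K' → μ K' < ⊤) → μ (frontier D.carrier)ᶜ = 0 → (∀ z ∈ frontier D.carrier, z ≠ D.pt 0 → ∀ (k : Fin 6) (s : ℝ), 0 < s → D.carrier ∩ Metric.ball z s = halfPlane k z ∩ Metric.ball z s → (∀ᶠ δ : ℝ in 𝓝[>] 0, ∃ nthr : ℤ, ∀ v : HexVertex, (δ : ℂ) * hexCenter v ∈ Metric.ball z s → (v ∈ Λ δ ↔ nthr ≤ zigzagForm k v)) → D.pt 0 ∉ Metric.closedBall z s → ∀ z' ∈ frontier D.carrier ∩ Metric.ball z s, κ z' = κ z) → (∀ z ∈ frontier D.carrier, z ≠ D.pt 0 → ∀ (k : Fin 6) (s : ℝ), 0 < s → D.carrier ∩ Metric.ball z s = halfPlane k z ∩ Metric.ball z s → (∀ᶠ δ : ℝ in 𝓝[>] 0, ∃ nthr : ℤ, ∀ v : HexVertex, (δ : ℂ) * hexCenter v ∈ Metric.ball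 z s → (v ∈ Λ δ ↔ nthr ≤ zigzagForm k v)) → D.pt 0 ∉ Metric.closedBall z s → ∀ φ : ℂ → ℂ, ContDiff ℝ ∞ φ → HasCompactSupport φ → tsupport φ ⊆ Metric.ball z (s / 2) → ∫ w in D.carrier, g w * Literature.Analysis.Complex.dbarAlong 1 φ w = -(Real.sqrt 3 : ℂ) * innerNormal k * κ z * ∫ w, φ w ∂μ) → (∀ z ∈ frontier D.carrier, z ≠ D.pt 0 → ∀ (k : Fin 6) (s : ℝ), 0 < s → D.carrier ∩ Metric.ball z s = halfPlane k z ∩ Metric.ball z s → (∀ᶠ δ : ℝ in 𝓝[>] 0, ∃ nthr : ℤ, ∀ v : HexVertex, (δ : ℂ) * hexCenter v ∈ Metric.ball z s → (v ∈ Λ δ ↔ nthr ≤ zigzagForm k v)) → D.pt 0 ∉ Metric.closedBall z s → ∃ α : ℝ, Filter.Tendsto (fun w => (L w).im) (𝓝[D.carrier] z) (𝓝 α) ∧ κ z * innerNormal k * Complex.exp ((3 / 8 : ℂ) * (α : ℂ) * Complex.I) = Complex.I * Complex.exp ((3 / 8 : ℂ) * (Lb.im : ℂ) * Complex.I)) →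 MeasurableSet Gs → Gs ⊆ frontier D.carrier \ {D.pt 0} → (∀ z, wt z = Real.exp ((3 / 8 : ℝ) * limUnder (𝓝[D.carrier] z) (fun w => (L w).re))) → AEMeasurable wt (μ.restrict Gs) → AEMeasurable (fun z => (Φs z).re) (μ.restrict Gs) → 0 < c₀ → (c₀ : ℂ) * Complex.exp ((θ₀ : ℂ) * Complex.I) = -(Real.sqrt 3 : ℂ) * Complex.I * Complex.exp ((3 / 8 : ℂ) * (Lb.im : ℂ) * Complex.I) * Complex.exp ((5 / 8 : ℂ) * Lb) → ν = MeasureTheory.Measure.map (fun z => (Φs z).re) ((μ.restrict Gs).withDensity fun z => ENNReal.ofReal (c₀ * wt z)) → (∀ w : ℂ, 0 < w.im → K w = g (Φ.symm w) * Complex.exp (-(5 / 8 : ℂ) * (L (Φ.symm w) - Lb))) → z₀ ∈ frontier D.carrier → 0 < s → D.carrier ∩ Metric.ball z₀ s = halfPlane k z₀ ∩ Metric.ball z₀ s → (∀ᶠ δ : ℝ in 𝓝[>] 0, ∃ nthr : ℤ, ∀ v : HexVertex, (δ : ℂ) * hexCenter v ∈ Metric.ball z₀ s → (v ∈ Λ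 δ ↔ nthr ≤ zigzagForm k v)) → D.pt 0 ∉ Metric.closedBall z₀ s → frontier D.carrier ∩ Metric.ball z₀ s ⊆ Gs → 0 < rmax → ∃ r : ℝ, 0 < r ∧ r ≤ rmax ∧ ν (Set.Ioo ((Φs z₀).re - r) ((Φs z₀).re + r)) < ⊤ ∧ MeasureTheory.IntegrableOn K (Metric.ball (((Φs z₀).re : ℝ) : ℂ) r ∩ {w : ℂ | 0 < w.im}) ∧ ∀ φ : ℂ → ℂ, ContDiff ℝ ∞ φ → HasCompactSupport φ → tsupport φ ⊆ Metric.ball (((Φs z₀).re : ℝ) : ℂ) r → ∫ w in Metric.ball (((Φs z₀).re : ℝ) : ℂ) r ∩ {w : ℂ | 0 < w.im}, K w * Literature.Analysis.Complex.dbarAlong 1 φ w = Complex.exp ((θ₀ : ℂ) * Complex.I) * ∫ x in Set.Ioo ((Φs z₀).re - r) ((Φs z₀).re + r), φ x ∂ν :=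
  fun D Λ Φ _Φs _L _Lb _g _μ _κ _Gs _wt _c₀ _θ₀ _ν _K _z₀ _k _s _rmax hΦsc hΦse hΦsr hΦsi hL hexp hgi hμK hμs
      hK2c hK2i hPH hGm hGsub hwt hwtm hΦrm hc₀ hC hν hK hz₀ hs hflat hlat h0 hGball hrmax =>
    flat_pairing D Λ Φ hΦsc hΦse hΦsr hΦsi hL hexp hgi hμK hμs hK2c hK2i hPH hGm hGsub hwt hwtm hΦrm hc₀
      hC hν hK hz₀ hs hflat hlat h0 hGball hrmax

end Transport
end Summit.CriticalPhenomena.SAWScalingLimit.Theorems.PolygonParitySqueeze
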